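import Summits.QuantumFields.BalabanUV.Beta.FP.StencilMoments
import Literature.MathematicalPhysics.QuantumFieldTheory.Balaban1983to89.Beta.LatticeConstantZl

/-!
# `BalabanUV.Beta.FP.TransportProfileMoments` — road «FP», N7 H-route, row H3-BOOK: THE MOMENT LETTERS OF AN EXPONENTIALLY LOCALISED TRANSPORT PROFILE —
# `|Σ'_x p(x)·w(x)| ≤ c·κ_k(a)·(1 + 4/a)^D` for a weight of growth `(|x|₁+1)^k` and `|w x| ≤ c·e^{−a|x|₁}`; at the transport scale `a = δ/N` the `k`-th moment is
# `O(N^{k+D})`·c (the N-powers of the (T0)-defect letters of `FP/HorizontalBookkeeping.pow_six_mul_abs_t0Defect_le`) ([folklore], `ℤ^D`)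

HONEST DEPENDENCY (page 1, mandatory): continuum YM on T⁴ ⇐ BetaPertH ∧ nine spine estimates (0/9 proved); BetaPertH ⇐ (D1) ∧ (D4) ∧
CAP+tail; G-an2-4 gates asym, D1 and NE2/3/4.  HONEST FRAMING (cell contract, verbatim): «discharging `BetaPertH` makes Bałaban's UV
stability UNCONDITIONAL — a real constructive-QFT result; it is NOT the continuum limit and NOT the Clay problem.»  THIS MODULE is elementary [folklore]
lattice summation composed BY NAME from `FP/StencilMoments.summable_of_weight_exp` (this lineage) and b12's `LatticeConstantZl.Zl_le_elem`; it cites nothing,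
defines nothing, mints no `Prop` fact, 0 sorry.  The profile bound is a HYPOTHESIS (row IPROF-UNIF supplies it for the perfect minimiser columns; not here).
NOT H3-BOOK (b) itself (the tail comparison), NOT `hasym`, NOT D1, NOT BetaPertH, NOT continuum, NOT Clay.
Unit `b2b-balaban-beta-d1-formalise-leaf-02` (gen 5).
-/

noncomputable section

namespace Summit.QuantumFields.BalabanUV.Beta.FP.TransportProfileMoments

open Finset
open scoped BigOperators
open Literature.MathematicalPhysics.QuantumFieldTheory.Balaban1983to89
open Literature.MathematicalPhysics.QuantumFieldTheory.Balaban1983to89.Beta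
open B12Sec2to5 (l1 l1_nonneg abs_coord_le_l1)
open ExpKernelCalculus (Site Zl Zl_pos)
open LatticeConstantZl (Zl_le_elem)
open Summit.QuantumFields.BalabanUV.Beta.FP.StencilMoments (summable_of_weight_exp)

variable {D : ℕ}

/-! ## §1 The generic weighted moment bound -/

/-- **WEIGHTED MOMENTS OF AN EXPONENTIALLY LOCALISED PROFILE**: `|w x| ≤ c·e^{−a|x|₁}` (`a > 0`, `c ≥ 0`) and a real weight with `|p x| ≤ (|x|₁+1)^k` ⟹
`x ↦ p x · w x` is summable and `|Σ'_x p x · w x| ≤ c·(k!·e^{a/2}·(2/a)^k)·Zl D (a/2)`. [folklore] -/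
theorem summable_and_abs_tsum_le {w p : Site D → ℝ} {c a : ℝ} (ha : 0 < a) (hc : 0 ≤ c) {k : ℕ}
    (hw : ∀ x, |w x| ≤ c * Real.exp (-a * l1 x)) (hp : ∀ x, |p x| ≤ (l1 x + 1) ^ k) :
    Summable (fun x => p x * w x)
      ∧ |∑' x, p x * w x| ≤ c * (((k.factorial : ℝ) * Real.exp (a / 2) * (2 / a) ^ k) * Zl D (a / 2)) := by
  obtain ⟨hs, hb⟩ := summable_of_weight_exp (q := (0 : Site D)) (k := k) ha hc (g := fun x => p x * w x) (fun x => by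
    rw [sub_zero, abs_mul]
    calc |p x| * |w x| ≤ (l1 x + 1) ^ k * (c * Real.exp (-a * l1 x)) :=
          mul_le_mul (hp x) (hw x) (abs_nonneg _) (pow_nonneg (by linarith [l1_nonneg x]) k)
      _ = c * (l1 x + 1) ^ k * Real.exp (-a * l1 x) := by ring)
  refine ⟨hs, ?_⟩
  have h1 : |∑' x, p x * w x| ≤ ∑' x, |p x * w x| := by
    have := norm_tsum_le_tsum_norm hs.norm
    simpa only [Real.norm_eq_abs] using this
  exact h1.trans (hb.trans (le_of_eq (by ring)))

/-- [folklore] The same with the lattice constant eliminated: `Zl D (a/2) ≤ (1 + 4/a)^D` (`LatticeConstantZl.Zl_le_elem`). -/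
theorem abs_tsum_le_elem {w p : Site D → ℝ} {c a : ℝ} (ha : 0 < a) (hc : 0 ≤ c) {k : ℕ}
    (hw : ∀ x, |w x| ≤ c * Real.exp (-a * l1 x)) (hp : ∀ x, |p x| ≤ (l1 x + 1) ^ k) :
    |∑' x, p x * w x| ≤ c * ((k.factorial : ℝ) * Real.exp (a / 2) * (2 / a) ^ k) * (1 + 4 / a) ^ D := by
  refine (summable_and_abs_tsum_le ha hc hw hp).2.trans ?_
  rw [← mul_assoc]
  refine mul_le_mul_of_nonneg_left ((Zl_le_elem (half_pos ha) D).trans (le_of_eq ?_)) (by positivity)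
  congr 1; ring

/-! ## §2 The three letters: mass, first and second moments -/

section Letters

variable {w : Site D → ℝ} {c a : ℝ}

/-- [folklore] MASS: `|Σ'_x w x| ≤ c·e^{a/2}·(1 + 4/a)^D`. -/
theorem abs_tsum_mass_le (ha : 0 < a) (hc : 0 ≤ c) (hw : ∀ x, |w x| ≤ c * Real.exp (-a * l1 x)) :
    |∑' x, w x| ≤ c * Real.exp (a / 2) * (1 + 4 / a) ^ D := by
  have h := abs_tsum_le_elem (D := D) (k := 0) ha hc hw (p := fun _ => 1) (fun x => by simp)
  simp only [one_mul, Nat.factorial_zero, Nat.cast_one, pow_zero, mul_one] at h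
  simpa only [mul_assoc] using h

/-- [folklore] FIRST MOMENT: `|Σ'_x x_μ • w x| ≤ c·(e^{a/2}·(2/a))·(1 + 4/a)^D`. -/
theorem abs_tsum_first_le (ha : 0 < a) (hc : 0 ≤ c) (hw : ∀ x, |w x| ≤ c * Real.exp (-a * l1 x)) (μ : Fin D) :
    |∑' x, x μ • w x| ≤ c * (Real.exp (a / 2) * (2 / a)) * (1 + 4 / a) ^ D := by
  have h := abs_tsum_le_elem (D := D) (k := 1) ha hc hw (p := fun x => (x μ : ℝ)) (fun x => by
    rw [pow_one]; linarith [abs_coord_le_l1 x μ])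
  simp only [Nat.factorial_one, Nat.cast_one, one_mul, pow_one] at h
  have e : (fun x : Site D => x μ • w x) = fun x => (x μ : ℝ) * w x := funext fun x => by rw [zsmul_eq_mul]
  rw [e]; exact h

/-- [folklore] SECOND MOMENT: `|Σ'_x (x_κ x_λ) • w x| ≤ c·(2·e^{a/2}·(2/a)²)·(1 + 4/a)^D`. -/
theorem abs_tsum_second_le (ha : 0 < a) (hc : 0 ≤ c) (hw : ∀ x, |w x| ≤ c * Real.exp (-a * l1 x)) (κ l : Fin D) :
    |∑' x, (x κ * x l) • w x| ≤ c * (2 * Real.exp (a / 2) * (2 / a) ^ 2) * (1 + 4 / a) ^ D := by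
  have h := abs_tsum_le_elem (D := D) (k := 2) ha hc hw (p := fun x => (x κ : ℝ) * (x l : ℝ)) (fun x => by
    rw [abs_mul]
    have h1 := abs_coord_le_l1 x κ; have h2 := abs_coord_le_l1 x l
    have h0 : 0 ≤ l1 x := l1_nonneg x
    nlinarith [mul_le_mul h1 h2 (abs_nonneg _) h0, abs_nonneg (x κ : ℝ)])
  simp only [Nat.factorial_two, Nat.cast_ofNat] at h
  have e : (fun x : Site D => (x κ * x l) • w x) = fun x => (x κ : ℝ) * (x l : ℝ) * w x := funext fun x => by
    rw [zsmul_eq_mul, Int.cast_mul]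
  rw [e]; exact h

end Letters

/-! ## §3 At the transport scale `a = δ/N`: the `N`-powers -/

/-- **THE N-POWERS OF THE PROFILE LETTERS** at rate `a = δ/N` (`0 < δ`, `1 ≤ N`): `e^{a/2} ≤ e^{δ/2}`, `2/a = 2N/δ`, `1 + 4/a ≤ (1 + 4/δ)·N`; hence for
`|w x| ≤ c·e^{−(δ/N)|x|₁}`: mass `≤ c·e^{δ/2}(1+4/δ)^D·N^D`, first moment `≤ c·e^{δ/2}(2/δ)(1+4/δ)^D·N^{D+1}`, second moment `≤ c·2e^{δ/2}(2/δ)²(1+4/δ)^D·N^{D+2}`. [folklore] -/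
theorem letters_at_scale {w : Site D → ℝ} {c δ : ℝ} {N : ℕ} (hδ : 0 < δ) (hN : 1 ≤ N) (hc : 0 ≤ c)
    (hw : ∀ x, |w x| ≤ c * Real.exp (-(δ / N) * l1 x)) (μ κ l : Fin D) :
    |∑' x, w x| ≤ c * (Real.exp (δ / 2) * (1 + 4 / δ) ^ D) * (N : ℝ) ^ D
      ∧ |∑' x, x μ • w x| ≤ c * (Real.exp (δ / 2) * (2 / δ) * (1 + 4 / δ) ^ D) * (N : ℝ) ^ (D + 1)
      ∧ |∑' x, (x κ * x l) • w x| ≤ c * (2 * Real.exp (δ / 2) * (2 / δ) ^ 2 * (1 + 4 / δ) ^ D) * (N : ℝ) ^ (D + 2) := by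
  have hN' : (1 : ℝ) ≤ N := by exact_mod_cast hN
  have hNpos : (0 : ℝ) < N := by linarith
  have ha : 0 < δ / N := div_pos hδ hNpos
  -- the three scale conversions
  have hexp : Real.exp (δ / N / 2) ≤ Real.exp (δ / 2) := by
    apply Real.exp_le_exp.mpr
    rw [div_div, div_le_div_iff_of_pos_left hδ (by positivity) (by norm_num)]
    linarith
  have h2a : 2 / (δ / N) = 2 / δ * N := by field_simp
  have h4a : 1 + 4 / (δ / N) ≤ (1 + 4 / δ) * N := by
    rw [div_div_eq_mul_div, add_mul, one_mul]
    have : (0 : ℝ) ≤ 4 / δ * N := by positivity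
    nlinarith [div_mul_eq_mul_div 4 δ (N : ℝ)]
  have h4a0 : 0 ≤ 1 + 4 / (δ / N) := by positivity
  have hpowD : (1 + 4 / (δ / N)) ^ D ≤ (1 + 4 / δ) ^ D * (N : ℝ) ^ D := by
    rw [← mul_pow]; exact pow_le_pow_left₀ h4a0 h4a D
  refine ⟨?_, ?_, ?_⟩
  · refine (abs_tsum_mass_le ha hc hw).trans ?_
    calc c * Real.exp (δ / N / 2) * (1 + 4 / (δ / N)) ^ D ≤ c * Real.exp (δ / 2) * ((1 + 4 / δ) ^ D * (N : ℝ) ^ D) := by gcongr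
      _ = _ := by ring
  · refine (abs_tsum_first_le ha hc hw μ).trans ?_
    rw [h2a]
    calc c * (Real.exp (δ / N / 2) * (2 / δ * N)) * (1 + 4 / (δ / N)) ^ D
        ≤ c * (Real.exp (δ / 2) * (2 / δ * N)) * ((1 + 4 / δ) ^ D * (N : ℝ) ^ D) := by gcongr
      _ = _ := by ring
  · refine (abs_tsum_second_le ha hc hw κ l).trans ?_
    rw [h2a]
    calc c * (2 * Real.exp (δ / N / 2) * (2 / δ * N) ^ 2) * (1 + 4 / (δ / N)) ^ D
        ≤ c * (2 * Real.exp (δ / 2) * (2 / δ * N) ^ 2) * ((1 + 4 / δ) ^ D * (N : ℝ) ^ D) := by gcongr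
      _ = _ := by ring

end Summit.QuantumFields.BalabanUV.Beta.FP.TransportProfileMoments

end
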